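import Summits.CriticalPhenomena.PercolationContinuityZ3.Theorems.PercNearOneGluingNoHeavyPcintTFibDominating
import Summits.CriticalPhenomena.PercolationContinuityZ3.Theorems.PercNearOneGluingNoHeavyPcintTFibBridgeT
import Summits.CriticalPhenomena.PercolationContinuityZ3.Theorems.PercNearOneGluingNoHeavyPcintTFibBridgeF
import Summits.CriticalPhenomena.PercolationContinuityZ3.Theorems.PercNearOneGluingNoHeavyPcintTFibTable3
import Summits.CriticalPhenomena.PercolationContinuityZ3.Theorems.PercNearOneGluingNoHeavyPcintTFibTable5
import Literature.Probability.Percolation.SiteSharpnessDecay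
import Literature.Probability.Percolation.TriSharpness
import HarnessLib

/-!
# PCINT lane, T-fibre route assembled: `p_c^site(𝕋 × K₃) ≤ 0.4335`, `p_c^site(𝕋 × K₅) ≤ 0.3815`; site cells `d = 4, 5, 8`

Cell `prim-pcint`, seat `prim-pcint-1` (gen 11); memo `run/shared/lean/prim/pcint/T-FIBRE-ROUTE.md`.

Site percolation on the triangular lattice `𝕋` at `s = 0.5001 > 1/2 = p_c^site(𝕋)` percolates
(`triTheta_pos_of_half_lt`, Kesten 1982).  Its cluster exploration is dominated step-wise by the fibre process on
`𝕋 × K_m` at density `p` (`TFib.dominating` with the tables `TFib.table3` / `TFib.table5`), so by the coupling-free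
domination theorem `AdaptDom.expect_le_of_dominating` and the two bridges,

  `P_s^𝕋(0 ⟷ ∂ⁱⁿ box n) ≤ p^{-m} · P_p^{𝕋 × K_m}((0,0) ⟷ ∂ⁱⁿ (box n × K_m))`   (`TFib.exit_le`),

hence `θ^site_𝕋(s) ≤ p^{-m} θ^site_{𝕋 × K_m}(p)` and `p_c^site(𝕋 × K_m) ≤ p`:

* `TFib.siteCriticalProb_tfib3_le` : `p_c^site(𝕋 × K₃) ≤ 867/2000 = 0.4335`;
* `TFib.siteCriticalProb_tfib5_le` : `p_c^site(𝕋 × K₅) ≤ 763/2000 = 0.3815`;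

and with the coverings `ℤ⁴ → 𝕋 × K₃`, `ℤ⁵ → 𝕋 × K₅` (`…PcintTFibGraph.lean`) and Gomes–Pereira–Sanchis's Lemma 2
(`AxisGrouping.siteCriticalProb_zd_mul_le_real`), the SITE UPPER CELLS

* **`TFib.siteCriticalProb_Z4_le_04335`** : `p_c^site(ℤ⁴) ≤ 0.4335` (was `0.444`; printed bound `0.4344`),
* **`TFib.siteCriticalProb_Z5_le_03815`** : `p_c^site(ℤ⁵) ≤ 0.3815` (was `0.425`; printed bound `0.4156`),
* **`TFib.siteCriticalProb_Z8_le_02474`** : `p_c^site(ℤ⁸) ≤ 0.2474` (was `0.2544`; printed bound `0.2479`),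

with the monotone-in-`d` versions.  All three are below the printed values of Gomes–Pereira–Sanchis (J. Appl. Probab.
63 (2026), Thm. 3, resting on Wierman's `p_c^site(ℤ²) ≤ 0.679492`).
-/

noncomputable section

namespace Summit.CriticalPhenomena.PercolationContinuityZ3.Theorems.Pcint

namespace TFib

open Finset Filter Topology MeasureTheory AdaptDom ClusterExpl
  Literature.Probability.Percolation Literature.Probability.LatticeModels

variable {m : ℕ} [NeZero m]

/-! ### The box inequality -/

section Generic

variable {Λ : Finset (Site 2)} (pU sU : unitInterval)

open Classical in
/-- **The comparison inequality on a box**: under step-wise domination, the `π_s`-probability that `o` is joined to `B`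
by open sites of `Λ` (in `𝕋`) is at most the `muF`-weight of the fibre-state assignments with an open `𝕋 × K_m`-path of
`cfgF w` from `(o, 0)` to the fibre of a site of `B`. -/
theorem sum_wt_reach_le_sum_muF_path (enc : ↥Λ → ℕ) (o : ↥Λ) (B : Finset ↥Λ) (hp : 0 < (pU : ℝ))
    (hdom : Dominating (sU : ℝ) (rule (boxGraphT Λ) enc o) (muF o (pU : ℝ)) (outF m Λ enc)) :
    ∑ ω : ↥Λ → Bool, wt (sU : ℝ) ω * reachIndicator (boxGraphT Λ) o B ω ≤
      ∑ w : ↥Λ → (ZMod m → Bool), muF o (pU : ℝ) w *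
        (if ∃ v ∈ B, ∃ j : ZMod m, PathIn (tfib m) (cfgF m Λ w) (o.1, 0) (v.1, j) then (1 : ℝ) else 0) := by
  set N := Fintype.card ↥Λ + 1 with hN
  let ω₀ : ↥Λ → Bool := fun _ => false
  have h1 := expect_le_of_dominating sU.2.1 sU.2.2 (reachIndicator_mono (boxGraphT Λ) o B)
    (rule (boxGraphT Λ) enc o) (rule_unrevealed (boxGraphT Λ) enc o) (muF o (pU : ℝ)) (sum_muF hp) (outF m Λ enc)
    hdom N ω₀ (fun w ω => reach_determined (boxGraphT Λ) enc o B (outF m Λ enc w) ω ω₀)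
  refine h1.trans (Finset.sum_le_sum fun w _ => mul_le_mul_of_nonneg_left ?_ (muF_nonneg pU.2.1 pU.2.2 hp w))
  unfold reachIndicator
  split_ifs with hreach hpath
  · exact le_rfl
  · exfalso
    apply hpath
    have hval : reachIndicator (boxGraphT Λ) o B (merge (run (rule (boxGraphT Λ) enc o) (outF m Λ enc w) N) ω₀) = 1 := by
      unfold reachIndicator; rw [if_pos hreach]
    exact exists_pathIn_of_reach (enc := enc) (o := o) w B ω₀ hval
  · norm_num
  · norm_num

end Generic

/-! ### From the box inequality to exit probabilities and to `θ` -/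

/-- The fibre sites above `Λ` are `Λ × ZMod m`. -/
theorem coe_fibSites (Λ : Finset (Site 2)) :
    (↑(fibSites (m := m) Λ) : Set (Site 2 × ZMod m)) = ↑(Λ ×ˢ (univ : Finset (ZMod m))) := by
  ext ⟨x, i⟩
  simp only [Finset.mem_coe, Finset.mem_product, Finset.mem_univ, and_true]
  constructor
  · intro h
    obtain ⟨v, j, hs⟩ := exists_eq_of_mem_fibSites Λ h
    simp only [Prod.mk.injEq] at hs
    rw [hs.1]; exact v.2
  · intro hx; exact mk_mem_fibSites Λ ⟨x, hx⟩ i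

/-- A path of the path event exits the product box: `fibPathEvent ⊆ exitEvent (𝕋 × K_m) (Λ × ZMod m) (0,0)` when `B` is
the set of inner-boundary sites and `o = 0`. -/
theorem fibPathEvent_subset_exitEvent {Λ : Finset (Site 2)} (h0 : (0 : Site 2) ∈ Λ) :
    fibPathEvent (m := m) Λ ⟨0, h0⟩ (Λ.attach.filter fun v => v.1 ∈ innerBoundary triGraph Λ) ⊆
      exitEvent (tfib m) (Λ ×ˢ (univ : Finset (ZMod m))) ((0 : Site 2), (0 : ZMod m)) := by
  classical
  rintro ω ⟨v, hv, j, hpath⟩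
  have hvb : v.1 ∈ innerBoundary triGraph Λ := (mem_filter.1 hv).2
  obtain ⟨-, y, hy, hadj⟩ := mem_innerBoundary_iff.1 hvb
  rw [mem_exitEvent_iff]
  refine ⟨(v.1, j), mem_innerBoundary_iff.2 ⟨mem_product.2 ⟨v.2, mem_univ _⟩, (y, j), ?_, ?_⟩, ?_⟩
  · rw [mem_product]; exact fun h => hy h.1
  · exact (tfib_adj _ _).2 (Or.inl ⟨hadj, rfl⟩)
  · refine PathIn.mem_siteConnIn (hpath.mono fun s hs => ⟨?_, hs.1⟩)
    have := hs.2
    rw [coe_fibSites] at this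
    exact this

section Exit

variable (pU sU : unitInterval) (hp : 0 < (pU : ℝ))
  (hdom : ∀ (Λ : Finset (Site 2)) (enc : ↥Λ → ℕ) (o : ↥Λ),
    Dominating (sU : ℝ) (rule (boxGraphT Λ) enc o) (muF (m := m) o (pU : ℝ)) (outF m Λ enc))
include hp hdom

/-- **The box inequality in terms of exit probabilities**:
`P_s^𝕋(0 ⟷ ∂ⁱⁿ box n) ≤ p^{-m} · P_p^{𝕋 × K_m}((0,0) ⟷ ∂ⁱⁿ (box n × ZMod m))`. -/
theorem exit_le (n : ℕ) :
    (sitePercolation (Site 2) sU).real (exitEvent triGraph (box 2 n) 0) ≤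
      (1 / wt (pU : ℝ) (allOpen m)) *
        (sitePercolation (Site 2 × ZMod m) pU).real
          (exitEvent (tfib m) (box 2 n ×ˢ (univ : Finset (ZMod m))) ((0 : Site 2), (0 : ZMod m))) := by
  classical
  set Λ := box 2 n with hΛ
  have h0 : (0 : Site 2) ∈ Λ := zero_mem_box 2 n
  set o : ↥Λ := ⟨0, h0⟩ with ho
  set B := Λ.attach.filter fun v => v.1 ∈ innerBoundary triGraph Λ with hB
  let enc : ↥Λ → ℕ := fun _ => 0
  have hC : 0 < 1 / wt (pU : ℝ) (allOpen m) := div_pos one_pos (wt_allOpen_pos hp)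
  -- (a) the `𝕋` side, (b) domination
  have ha := real_exitEvent_le_sum_wt_reach h0 sU
  have hb := sum_wt_reach_le_sum_muF_path (m := m) pU sU enc o B hp (hdom Λ enc o)
  -- (c) weight comparison and (d) the fibre side
  have hcd : ∑ w : ↥Λ → (ZMod m → Bool), muF o (pU : ℝ) w *
        (if ∃ v ∈ B, ∃ j : ZMod m, PathIn (tfib m) (cfgF m Λ w) (o.1, 0) (v.1, j) then (1 : ℝ) else 0) ≤
      (1 / wt (pU : ℝ) (allOpen m)) * (sitePercolation (Site 2 × ZMod m) pU).real (fibPathEvent (m := m) Λ o B) := by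
    have hd := sum_pw_path_le_real_pathEvent (m := m) (Λ := Λ) pU o B
    calc _ ≤ ∑ w : ↥Λ → (ZMod m → Bool), pw (fun _ => wt (pU : ℝ)) w / wt (pU : ℝ) (allOpen m) *
          (if ∃ v ∈ B, ∃ j : ZMod m, PathIn (tfib m) (cfgF m Λ w) (o.1, 0) (v.1, j) then (1 : ℝ) else 0) :=
          Finset.sum_le_sum fun w _ => mul_le_mul_of_nonneg_right (muF_le_pw pU.2.1 pU.2.2 hp w)
            (by split_ifs <;> norm_num)
      _ = (1 / wt (pU : ℝ) (allOpen m)) * ∑ w : ↥Λ → (ZMod m → Bool), pw (fun _ => wt (pU : ℝ)) w *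
          (if ∃ v ∈ B, ∃ j : ZMod m, PathIn (tfib m) (cfgF m Λ w) (o.1, 0) (v.1, j) then (1 : ℝ) else 0) := by
          rw [Finset.mul_sum]
          exact Finset.sum_congr rfl fun w _ => by ring
      _ ≤ _ := mul_le_mul_of_nonneg_left hd hC.le
  -- (e) the path event is contained in the exit event of the product box
  have he : (sitePercolation (Site 2 × ZMod m) pU).real (fibPathEvent (m := m) Λ o B) ≤
      (sitePercolation (Site 2 × ZMod m) pU).real
        (exitEvent (tfib m) (Λ ×ˢ (univ : Finset (ZMod m))) ((0 : Site 2), (0 : ZMod m))) :=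
    measureReal_mono (fibPathEvent_subset_exitEvent (m := m) h0) (measure_ne_top _ _)
  calc (sitePercolation (Site 2) sU).real (exitEvent triGraph Λ 0)
      ≤ ∑ ω : ↥Λ → Bool, wt (sU : ℝ) ω * reachIndicator (boxGraphT Λ) o B ω := ha
    _ ≤ _ := hb
    _ ≤ (1 / wt (pU : ℝ) (allOpen m)) * (sitePercolation (Site 2 × ZMod m) pU).real (fibPathEvent (m := m) Λ o B) := hcd
    _ ≤ _ := mul_le_mul_of_nonneg_left he hC.le

/-- **`θ^site_𝕋(s) ≤ p^{-m} · θ^site_{𝕋 × K_m}((0,0), p)`.** -/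
theorem siteTheta_tri_le :
    siteTheta triGraph (0 : Site 2) sU ≤
      (1 / wt (pU : ℝ) (allOpen m)) * siteTheta (tfib m) ((0 : Site 2), (0 : ZMod m)) pU := by
  have hup : ∀ k : ℕ, siteTheta triGraph (0 : Site 2) sU ≤ (1 / wt (pU : ℝ) (allOpen m)) *
      (sitePercolation (Site 2 × ZMod m) pU).real
        (exitEvent (tfib m) (box 2 k ×ˢ (univ : Finset (ZMod m))) ((0 : Site 2), (0 : ZMod m))) := by
    intro k
    have h1 : siteTheta triGraph (0 : Site 2) sU ≤ (sitePercolation (Site 2) sU).real (exitEvent triGraph (box 2 k) 0) :=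
      measureReal_mono (sitePercolatesAt_subset_exitEvent (zero_mem_box 2 k)) (measure_ne_top _ _)
    exact h1.trans (exit_le pU sU hp hdom k)
  -- the product boxes exhaust `Site 2 × ZMod m`
  have hmono : Monotone (fun k : ℕ => box 2 k ×ˢ (univ : Finset (ZMod m))) :=
    fun a b hab => product_subset_product_left (box_mono 2 hab)
  have hex : ∀ v : Site 2 × ZMod m, ∃ k, v ∈ box 2 k ×ˢ (univ : Finset (ZMod m)) := fun v => by
    obtain ⟨k, hk⟩ := exists_mem_box v.1
    exact ⟨k, mem_product.2 ⟨hk, mem_univ _⟩⟩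
  have h00 : ((0 : Site 2), (0 : ZMod m)) ∈ box 2 0 ×ˢ (univ : Finset (ZMod m)) :=
    mem_product.2 ⟨zero_mem_box 2 0, mem_univ _⟩
  have hlim := tendsto_siteTheta (G := tfib m) hmono hex h00 pU
  have heq : ∀ k : ℕ, (⋂ i ≤ k, exitEvent (tfib m) (box 2 i ×ˢ (univ : Finset (ZMod m))) ((0 : Site 2), (0 : ZMod m))) =
      exitEvent (tfib m) (box 2 k ×ˢ (univ : Finset (ZMod m))) ((0 : Site 2), (0 : ZMod m)) := by
    intro k
    apply Set.Subset.antisymm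
    · intro ω hω; exact (Set.mem_iInter₂.1 hω) k le_rfl
    · exact Set.subset_iInter₂ fun i hi => exitEvent_anti (hmono hi) (mem_product.2 ⟨zero_mem_box 2 i, mem_univ _⟩)
  simp_rw [heq] at hlim
  exact ge_of_tendsto' (hlim.const_mul _) hup

/-- **`p_c^site(𝕋 × K_m) ≤ p`** whenever `s > 1/2` (so that `θ_𝕋(s) > 0`). -/
theorem siteCriticalProb_tfib_le (hs : (1 / 2 : ℝ) < sU) :
    siteCriticalProb (tfib m) ((0 : Site 2), (0 : ZMod m)) ≤ pU := by
  have hθT : 0 < siteTheta triGraph (0 : Site 2) sU := triTheta_pos_of_half_lt sU hs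
  have hC : 0 < 1 / wt (pU : ℝ) (allOpen m) := div_pos one_pos (wt_allOpen_pos hp)
  have hpos : 0 < siteTheta (tfib m) ((0 : Site 2), (0 : ZMod m)) pU := by
    have h := siteTheta_tri_le pU sU hp hdom
    by_contra hle
    have h0 : siteTheta (tfib m) ((0 : Site 2), (0 : ZMod m)) pU = 0 :=
      le_antisymm (not_lt.1 hle) (by unfold siteTheta; exact measureReal_nonneg)
    rw [h0, mul_zero] at h
    exact absurd h (not_le.2 hθT)
  exact siteCriticalProb_le_of_siteTheta_pos (tfib m) _ hpos

end Exit

/-! ### The instances `m = 3` (`p = 0.4335`) and `m = 5` (`p = 0.3815`) -/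

/-- **`p_c^site(𝕋 × K₃) ≤ 0.4335`.** -/
theorem siteCriticalProb_tfib3_le : siteCriticalProb (tfib 3) ((0 : Site 2), (0 : ZMod 3)) ≤ 867 / 2000 := by
  have h := siteCriticalProb_tfib_le (m := 3) ⟨867 / 2000, by norm_num, by norm_num⟩
    ⟨5001 / 10000, by norm_num, by norm_num⟩ (by norm_num)
    (fun Λ enc o => dominating (m := 3) enc (o := o) (p := (867 : ℝ) / 2000) (by norm_num) (by norm_num)
      (s := (5001 : ℝ) / 10000) (by norm_num) (by norm_num) (by norm_num)
      (fun h hh k hk1 hk j hj1 hjk => table3 h hh k hk1 hk j hj1 hjk))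
    (by norm_num)
  simpa using h

/-- **`p_c^site(𝕋 × K₅) ≤ 0.3815`.** -/
theorem siteCriticalProb_tfib5_le : siteCriticalProb (tfib 5) ((0 : Site 2), (0 : ZMod 5)) ≤ 763 / 2000 := by
  have h := siteCriticalProb_tfib_le (m := 5) ⟨763 / 2000, by norm_num, by norm_num⟩
    ⟨5001 / 10000, by norm_num, by norm_num⟩ (by norm_num)
    (fun Λ enc o => dominating (m := 5) enc (o := o) (p := (763 : ℝ) / 2000) (by norm_num) (by norm_num)
      (s := (5001 : ℝ) / 10000) (by norm_num) (by norm_num) (by norm_num)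
      (fun h hh k hk1 hk j hj1 hjk => table5 h hh k hk1 hk j hj1 hjk))
    (by norm_num)
  simpa using h

/-! ### The site upper cells -/

/-- **`p_c^site(ℤ⁴) ≤ 0.4335`** (was `0.444`; printed bound `0.4344`): the covering `ℤ⁴ → 𝕋 × K₃` and
`p_c^site(𝕋 × K₃) ≤ 0.4335`. -/
theorem siteCriticalProb_Z4_le_04335 : siteCriticalProb (zdGraph 4) (0 : Site 4) ≤ 0.4335 :=
  siteCriticalProb_Z4_le_tfib3.trans (siteCriticalProb_tfib3_le.trans (by norm_num))

/-- **`p_c^site(ℤ^d) ≤ 0.4335` for every `d ≥ 4`.** -/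
theorem siteCriticalProb_zd_le_04335 {d : ℕ} (hd : 4 ≤ d) : siteCriticalProb (zdGraph d) (0 : Site d) ≤ 0.4335 :=
  (AxisGrouping.siteCriticalProb_zd_anti hd).trans siteCriticalProb_Z4_le_04335

/-- **`p_c^site(ℤ⁵) ≤ 0.3815`** (was `0.425`; printed bound `0.4156`): the covering `ℤ⁵ → 𝕋 × K₅` and
`p_c^site(𝕋 × K₅) ≤ 0.3815`. -/
theorem siteCriticalProb_Z5_le_03815 : siteCriticalProb (zdGraph 5) (0 : Site 5) ≤ 0.3815 :=
  siteCriticalProb_Z5_le_tfib5.trans (siteCriticalProb_tfib5_le.trans (by norm_num))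

/-- **`p_c^site(ℤ^d) ≤ 0.3815` for every `d ≥ 5`.** -/
theorem siteCriticalProb_zd_le_03815 {d : ℕ} (hd : 5 ≤ d) : siteCriticalProb (zdGraph d) (0 : Site d) ≤ 0.3815 :=
  (AxisGrouping.siteCriticalProb_zd_anti hd).trans siteCriticalProb_Z5_le_03815

/-- **`p_c^site(ℤ⁸) ≤ 0.2474`** (was `0.2544`; printed bound `0.2479`): Gomes–Pereira–Sanchis's Lemma 2 with `k = 4`,
`m = 2` from `p_c^site(ℤ⁴) ≤ 0.4335`: `1 - √(1 - 0.4335) = 0.24733…`. -/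
theorem siteCriticalProb_Z8_le_02474 : siteCriticalProb (zdGraph 8) (0 : Site 8) ≤ 0.2474 := by
  have h4 := siteCriticalProb_Z4_le_04335
  have h' := AxisGrouping.siteCriticalProb_zd_mul_le_real (k := 4) (m := 2) (t₀ := 0.2474) (by norm_num)
    fun t ht ht1 => by
      have h0 : 0 ≤ 1 - t := by linarith
      have h2 : (1 - t) ^ 2 < (0.7526 : ℝ) ^ 2 := pow_lt_pow_left₀ (by linarith) h0 (by norm_num)
      norm_num at h2
      linarith
  exact h'

/-- **`p_c^site(ℤ^d) ≤ 0.2474` for every `d ≥ 8`.** -/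
theorem siteCriticalProb_zd_le_02474 {d : ℕ} (hd : 8 ≤ d) : siteCriticalProb (zdGraph d) (0 : Site d) ≤ 0.2474 :=
  (AxisGrouping.siteCriticalProb_zd_anti hd).trans siteCriticalProb_Z8_le_02474

end TFib

end Summit.CriticalPhenomena.PercolationContinuityZ3.Theorems.Pcint

end
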